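/-
Copyright (c) 2026 the pub-hodgecm-mathlib formalisation cell (harness21).  Prover seat hodgecm-mathlib-LH4-p12 (g0), Track A «FOUR-FRAME», unit U2H_HSide, (ρ)-child (b′),
dictionary first seat: brick (4c) «EIGENVALUE IDENTIFICATION + CONDUCTOR» of the hΦ discharge.  2026-09-03.
-/
import Summits.HodgeConjecture.HodgeConjecture.Theorems.F0P3cDyRamTypeOneDepthLaw         -- ★ p855609 (this seat): the depth law `N = 2n + d`, `depth_dichotomy`
import Literature.NumberTheory.Automorphic.SLTwoTreeQuadraticTorusNormalForm               -- ★ p855546 (LH4-p13): `trace_smul_torusFormOne`, `det_smul_torusFormOne`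
import Literature.NumberTheory.Automorphic.RamifiedPlaceEisensteinBasis                    -- ★ `valued_toPlace_eq_sq_of_ramified` (`|ι y|_w = |y|_v²`)
import Literature.NumberTheory.Automorphic.ValuedFieldValuativeRelBridge                   -- ★ `v_eq_iff_valuation_eq` (Valued ↔ ValuativeRel currencies)
import HarnessLib

/-!
# F0 · P3c · line «(D-RAM) FOUR-FRAME» — U2H (b′) dictionary, brick (4c): THE EIGENVALUES OF A TYPE-(1) ELEMENT ARE `s·c·(1 + bτ)`, `s·c·(1 + bστ)`, AND THE
# CONDUCTOR OF ITS TORUS FORM IS `|b|_v = |ϖ_v|^{(N − d)∕2}`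

Cell `pub/hodgecm-mathlib`, crux H413 = `stmt-HodgeConjecture-24833` (helper lane `--supports stmt-HodgeConjecture-24833 --as helper`), route HCCMUnconditional; unit
U2H_HSide, (ρ)-child (b′) «ROW (1) H-SIDE DEPTH IDENTITY».  The (e₀)-twin capstone ★ p855773 `F0P3cDyRamHSideTypeOneTorusForm` gives `Φ^st(γ_H, hFamily s) = ν·2N`
with `N`'s ℕ-law in the census depth `n` (`|b|_v = |ϖ_v|ⁿ` for the torus form `(1, bv; b, 1 + bu)` of the descent representative); ★ p855670's binder `hΦ` (LH4-p08 (g2))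
wants the value at the ROW DEPTH `N = v_w(α − γ)` of the two roots `α, γ` of `γ₂` at `w`.  This file is the bridge:

* §1 (generic algebra, any fields `ι : F →+* E`): under the descent invariants `tr U = s·ι(tr g)`, `det U = s²·ι(det g)` (★ `trace_eq_smul_of_descent`,
  `det_eq_smul_of_descent`), the torus form `↑(h g h⁻¹) = c•↑γ₁`, `↑γ₁ = (1, bv; b, 1 + bu)` and a splitting `ι u = τ + τ′`, `ι v = −ττ′` of the datum in `E`:
  **`charpoly U = (X − s·ιc·(1 + ιb·τ))·(X − s·ιc·(1 + ιb·τ′))`**, so two distinct roots `α ≠ γ` of `charpoly U` are these two numbers, and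
  **`α·(1 + ιb·τ′) = γ·(1 + ιb·τ)` up to swapping `α, γ`** (`ratio_of_isRoot_of_isRoot`).
* §2 (CM currency, `E = L_w`, `F = L⁺_v`, `ι = toPlace v w`, datum of record `IsRamifiedQuadraticDatum σ_w ϖ d t`, `τ = ϖ`, `τ′ = σ_w ϖ`): with `|α|_w = |γ|_w = 1`
  (norm one), `b ∈ 𝒪_v`, `b ≠ 0`, `|α − γ|_w = exp(−N)` and `d ≤ N`: **`|ι b|_w = |ϖ|^{N − d}`, `N ≡ d (mod 2)`, and `|b|_v = |ϖ_v|^{(N − d)∕2}`** in both the `Valued` and the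
  `ValuativeRel` currencies (★ p855609 `valuation_le_of_le_depth` ∕ `depth_dichotomy` + ★ `valued_toPlace_eq_sq_of_ramified`) — the binder `hbn` of ★ p855257 ∕ ★ p855773
  at `n = (N − d)∕2`, i.e. the (b′) radius `(N + 2 − d)∕2 = n + 1`.

HONEST LABEL: HC_CM is proved only modulo the 7 printed citations (2 remaining named inputs: hLiu418 = stmt-HodgeConjecture-24832, h413 = stmt-HodgeConjecture-24833) until rung 0
closes; count-neutral helper.

## References
* [LabesseLanglands1979] J.-P. Labesse, R. P. Langlands, *L-indistinguishability for SL(2)*, Canad. J. Math. 31 (1979), §2 pp. 7–8 (the torus `(a, bv; b, a + bu)`, its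
  eigenvalues `a + bτ`, conductor).
* [Rogawski1990] J. D. Rogawski, *Automorphic Representations of Unitary Groups in Three Variables*, §4.9 Prop. 4.9.1 p. 55 (the H-side census by root depth).
* [Serre1979] J.-P. Serre, *Local Fields*, GTM 67, Ch. I §6 (Eisenstein equations), Ch. XIV §4 (descent).
-/

set_option autoImplicit false

noncomputable section

open scoped WithZero Matrix MatrixGroups ValuativeRel
open Matrix Polynomial NumberField IsDedekindDomain ValuativeRel

namespace Summit.HodgeConjecture.HodgeConjecture.Cruxes.H413.F0P3cDyRamTypeOneTorusConductor

open Literature.NumberTheory.Automorphic Literature.NumberTheory.Automorphic.UnitaryThreeFourFrame Literature.NumberTheory.Automorphic.HermitianLatticeTree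
open Literature.NumberTheory.Automorphic.UnitaryGroup Literature.NumberTheory.GaloisRepresentations
open Summit.HodgeConjecture.HodgeConjecture.Cruxes.H413.F0P3cDyRamTypeOneDepthLaw

/-! ## §1 Generic algebra: the characteristic polynomial of `U` under descent + torus form -/

section Generic

variable {F E : Type*} [Field F] [Field E] (ι : F →+* E)

omit ι in
/-- `tr g = c·(2 + bu)` when `↑(h g h⁻¹) = c•(1, bv; b, 1 + bu)` (trace is conjugation invariant; ★ `trace_smul_torusFormOne`). [cite: LabesseLanglands1979, §2 p. 7] -/
theorem trace_eq_of_conj_smul_torusFormOne {g h γ₁ : GL (Fin 2) F} {c b u v : F}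
    (hconj : ((h * g * h⁻¹ : GL (Fin 2) F) : Matrix (Fin 2) (Fin 2) F) = c • (γ₁ : Matrix (Fin 2) (Fin 2) F))
    (hγ₁ : (γ₁ : Matrix (Fin 2) (Fin 2) F) = !![1, b * v; b, 1 + b * u]) :
    (g : Matrix (Fin 2) (Fin 2) F).trace = c * (2 + b * u) := by
  have h1 : ((h * g * h⁻¹ : GL (Fin 2) F) : Matrix (Fin 2) (Fin 2) F).trace = (g : Matrix (Fin 2) (Fin 2) F).trace := by
    rw [Units.val_mul, Units.val_mul]
    exact Matrix.trace_units_conj h (g : Matrix (Fin 2) (Fin 2) F)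
  rw [← h1, hconj, hγ₁, trace_smul_torusFormOne]

omit ι in
/-- `det g = c²·(1 + bu − b²v)` when `↑(h g h⁻¹) = c•(1, bv; b, 1 + bu)` (★ `det_smul_torusFormOne`). [cite: LabesseLanglands1979, §2 p. 7] -/
theorem det_eq_of_conj_smul_torusFormOne {g h γ₁ : GL (Fin 2) F} {c b u v : F}
    (hconj : ((h * g * h⁻¹ : GL (Fin 2) F) : Matrix (Fin 2) (Fin 2) F) = c • (γ₁ : Matrix (Fin 2) (Fin 2) F))
    (hγ₁ : (γ₁ : Matrix (Fin 2) (Fin 2) F) = !![1, b * v; b, 1 + b * u]) :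
    (g : Matrix (Fin 2) (Fin 2) F).det = c ^ 2 * (1 + b * u - b ^ 2 * v) := by
  have h1 : ((h * g * h⁻¹ : GL (Fin 2) F) : Matrix (Fin 2) (Fin 2) F).det = (g : Matrix (Fin 2) (Fin 2) F).det := by
    rw [Units.val_mul, Units.val_mul]
    exact Matrix.det_units_conj h (g : Matrix (Fin 2) (Fin 2) F)
  rw [← h1, hconj, hγ₁, det_smul_torusFormOne]

/-- **THE CHARACTERISTIC POLYNOMIAL OF `U` SPLITS AS `(X − s·ιc·(1 + ιb·τ))(X − s·ιc·(1 + ιb·τ′))`** under the descent invariants `tr U = s·ι(tr g)`,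
`det U = s²·ι(det g)`, the torus form of `g`, and a splitting `ι u = τ + τ′`, `ι v = −ττ′` of the datum in `E` (`1 + bτ`, `1 + bτ′` are the eigenvalues of
`(1, bv; b, 1 + bu)`). [cite: LabesseLanglands1979, §2 pp. 7–8] [cite: Serre1979, Ch. XIV §4] -/
theorem charpoly_eq_of_descent_torusFormOne {U : Matrix (Fin 2) (Fin 2) E} {s τ τ' : E} {g h γ₁ : GL (Fin 2) F} {c b u v : F}
    (htrU : U.trace = s * ι (g : Matrix (Fin 2) (Fin 2) F).trace) (hdetU : U.det = s ^ 2 * ι (g : Matrix (Fin 2) (Fin 2) F).det)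
    (hconj : ((h * g * h⁻¹ : GL (Fin 2) F) : Matrix (Fin 2) (Fin 2) F) = c • (γ₁ : Matrix (Fin 2) (Fin 2) F))
    (hγ₁ : (γ₁ : Matrix (Fin 2) (Fin 2) F) = !![1, b * v; b, 1 + b * u]) (hτ : ι u = τ + τ') (hττ' : ι v = -(τ * τ')) :
    U.charpoly = (X - C (s * ι c * (1 + ι b * τ))) * (X - C (s * ι c * (1 + ι b * τ'))) := by
  have hA : s * ι (g : Matrix (Fin 2) (Fin 2) F).trace = s * ι c * (1 + ι b * τ) + s * ι c * (1 + ι b * τ') := by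
    rw [trace_eq_of_conj_smul_torusFormOne hconj hγ₁, map_mul, map_add, map_mul, map_ofNat, hτ]
    ring
  have hB : s ^ 2 * ι (g : Matrix (Fin 2) (Fin 2) F).det = (s * ι c * (1 + ι b * τ)) * (s * ι c * (1 + ι b * τ')) := by
    rw [det_eq_of_conj_smul_torusFormOne hconj hγ₁, map_mul, map_pow, map_sub, map_add, map_one, map_mul, map_mul, map_pow, hτ, hττ']
    ring
  set r₁ : E := s * ι c * (1 + ι b * τ)
  set r₂ : E := s * ι c * (1 + ι b * τ')
  clear_value r₁ r₂
  rw [Matrix.charpoly_fin_two, htrU, hdetU, hA, hB, C_add, C_mul]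
  ring

/-- **THE TWO ROOTS.**  Under the hypotheses of `charpoly_eq_of_descent_torusFormOne`, two DISTINCT roots `α ≠ γ` of `charpoly U` are `s·ιc·(1 + ιb·τ)` and
`s·ιc·(1 + ιb·τ′)` in some order. [cite: LabesseLanglands1979, §2 pp. 7–8] -/
theorem eq_or_eq_of_isRoot_of_isRoot {U : Matrix (Fin 2) (Fin 2) E} {s τ τ' : E} {g h γ₁ : GL (Fin 2) F} {c b u v : F}
    (htrU : U.trace = s * ι (g : Matrix (Fin 2) (Fin 2) F).trace) (hdetU : U.det = s ^ 2 * ι (g : Matrix (Fin 2) (Fin 2) F).det)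
    (hconj : ((h * g * h⁻¹ : GL (Fin 2) F) : Matrix (Fin 2) (Fin 2) F) = c • (γ₁ : Matrix (Fin 2) (Fin 2) F))
    (hγ₁ : (γ₁ : Matrix (Fin 2) (Fin 2) F) = !![1, b * v; b, 1 + b * u]) (hτ : ι u = τ + τ') (hττ' : ι v = -(τ * τ'))
    {α γ : E} (hα : U.charpoly.IsRoot α) (hγ : U.charpoly.IsRoot γ) (hαγ : α ≠ γ) :
    (α = s * ι c * (1 + ι b * τ) ∧ γ = s * ι c * (1 + ι b * τ')) ∨ (α = s * ι c * (1 + ι b * τ') ∧ γ = s * ι c * (1 + ι b * τ)) := by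
  rw [charpoly_eq_of_descent_torusFormOne ι htrU hdetU hconj hγ₁ hτ hττ'] at hα hγ
  rw [IsRoot, eval_mul, eval_sub, eval_sub, eval_X, eval_C, eval_C, mul_eq_zero, sub_eq_zero, sub_eq_zero] at hα hγ
  rcases hα with hα | hα <;> rcases hγ with hγ | hγ
  · exact absurd (hα.trans hγ.symm) hαγ
  · exact Or.inl ⟨hα, hγ⟩
  · exact Or.inr ⟨hα, hγ⟩
  · exact absurd (hα.trans hγ.symm) hαγ

/-- **THE RATIO**: `α·(1 + ιb·τ′) = γ·(1 + ιb·τ)` or the same with `α, γ` swapped — the binder `hratio` of ★ p855609 (`F0P3cDyRamTypeOneDepthLaw`) at `τ = ϖ`,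
`τ′ = σϖ`. [cite: LabesseLanglands1979, §2 pp. 7–8] -/
theorem ratio_of_isRoot_of_isRoot {U : Matrix (Fin 2) (Fin 2) E} {s τ τ' : E} {g h γ₁ : GL (Fin 2) F} {c b u v : F}
    (htrU : U.trace = s * ι (g : Matrix (Fin 2) (Fin 2) F).trace) (hdetU : U.det = s ^ 2 * ι (g : Matrix (Fin 2) (Fin 2) F).det)
    (hconj : ((h * g * h⁻¹ : GL (Fin 2) F) : Matrix (Fin 2) (Fin 2) F) = c • (γ₁ : Matrix (Fin 2) (Fin 2) F))
    (hγ₁ : (γ₁ : Matrix (Fin 2) (Fin 2) F) = !![1, b * v; b, 1 + b * u]) (hτ : ι u = τ + τ') (hττ' : ι v = -(τ * τ'))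
    {α γ : E} (hα : U.charpoly.IsRoot α) (hγ : U.charpoly.IsRoot γ) (hαγ : α ≠ γ) :
    α * (1 + ι b * τ') = γ * (1 + ι b * τ) ∨ γ * (1 + ι b * τ') = α * (1 + ι b * τ) := by
  rcases eq_or_eq_of_isRoot_of_isRoot ι htrU hdetU hconj hγ₁ hτ hττ' hα hγ hαγ with ⟨rfl, rfl⟩ | ⟨rfl, rfl⟩
  · exact Or.inl (by ring)
  · exact Or.inr (by ring)

end Generic

/-! ## §2 CM currency: the conductor `|b|_v = |ϖ_v|^{(N − d)∕2}` from the row depth -/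

section Place

variable (L : Type) [Field L] [NumberField L] [IsCMField L] (v : HeightOneSpectrum (𝓞 ↥(maximalRealSubfield L)))
  (w : PlacesOver L v) (hw : IsCMField.complexConj L • w.1 = w.1) (he : v.asIdeal.ramificationIdx' w.1.asIdeal ≠ 1)

include hw in
/-- **THE CONDUCTOR IN `E`-VALUATION: `|ι b|_w = |ϖ|^{N − d}`, with `d ≤ N` and `N ≡ d (mod 2)`.**  At the datum of record `(σ_w, ϖ, d, t)`, for `b ∈ L⁺_v`, `b ≠ 0`,
`|ι b|_w ≤ 1` (the torus form is integral: vertex type), norm-one `γ` with `α·(1 + ιb·σϖ) = γ·(1 + ιb·ϖ)` (§1) and depth `|α − γ|_w = |ϖ|^N`.  (★ p855609 `depth_dichotomy`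
at `x = 1`, `z = ι b`; the edge branch is excluded by `|ι b| ≤ 1`.) [cite: LabesseLanglands1979, §2 p. 8] [cite: Rogawski1990, §4.9 Prop. 4.9.1 p. 55] -/
theorem valued_toPlace_eq_pow_of_depth {ϖ : w.1.adicCompletion L} {d t : ℕ}
    (hD : IsRamifiedQuadraticDatum (galAdicCompletionMap (L := L) (IsCMField.complexConj L) hw) ϖ d t)
    {b : v.adicCompletion ↥(maximalRealSubfield L)} (hb0 : b ≠ 0) (hb1 : Valued.v (toPlace v w b) ≤ 1)
    {α γ : w.1.adicCompletion L} (hγ1 : Valued.v γ = 1)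
    (hratio : α * (1 + toPlace v w b * galAdicCompletionMap (L := L) (IsCMField.complexConj L) hw ϖ) = γ * (1 + toPlace v w b * ϖ))
    {N : ℕ} (hN : Valued.v (α - γ) = Valued.v ϖ ^ N) :
    Valued.v (toPlace v w b) = Valued.v ϖ ^ (N - d) ∧ d ≤ N ∧ N % 2 = d % 2 := by
  have hσ1 : galAdicCompletionMap (L := L) (IsCMField.complexConj L) hw (1 : w.1.adicCompletion L) = 1 := map_one _
  have hσb : galAdicCompletionMap (L := L) (IsCMField.complexConj L) hw (toPlace v w b) = toPlace v w b :=
    galAdicCompletionMap_toPlace (IsCMField.complexConj L) w w hw b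
  have hιb0 : toPlace v w b ≠ 0 := fun h => hb0 ((map_eq_zero_iff _ (toPlace v w).injective).1 h)
  have hratio' : α * galAdicCompletionMap (L := L) (IsCMField.complexConj L) hw (1 + toPlace v w b * ϖ) = γ * (1 + toPlace v w b * ϖ) := by
    rwa [map_add_mul_eq hσ1 hσb]
  rcases depth_dichotomy hD hσ1 hσb hιb0 hγ1 hratio' hN with ⟨-, hdN, hpar, hq⟩ | ⟨hlt, -⟩
  · rw [map_one, div_one] at hq
    exact ⟨hq, hdN, hpar⟩
  · exfalso
    rw [map_one] at hlt
    exact not_lt.2 hb1 hlt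

include hw he in
/-- **THE CONDUCTOR IN `F`-VALUATION: `|b|_v = |ϖ_v|^{(N − d)∕2}`** (`|ι b|_w = |b|_v²` at a ramified place, ★ `valued_toPlace_eq_sq_of_ramified`; `N − d` is even), in the
`Valued` currency and in the `ValuativeRel` currency of ★ p855257 ∕ ★ p855773's binder `hbn` — so the census radius is `n + 1 = (N + 2 − d)∕2`.
[cite: LabesseLanglands1979, §2 p. 8] [cite: Rogawski1990, §4.9 Prop. 4.9.1 p. 55] -/
theorem valuation_eq_pow_half_of_depth {ϖ : w.1.adicCompletion L} {d t : ℕ}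
    (hD : IsRamifiedQuadraticDatum (galAdicCompletionMap (L := L) (IsCMField.complexConj L) hw) ϖ d t)
    {ϖF : v.adicCompletion ↥(maximalRealSubfield L)} (hϖF : Valued.v ϖF = WithZero.exp (-1 : ℤ))
    {b : v.adicCompletion ↥(maximalRealSubfield L)} (hb0 : b ≠ 0) (hb : b ∈ 𝒪[v.adicCompletion ↥(maximalRealSubfield L)])
    {α γ : w.1.adicCompletion L} (hγ1 : Valued.v γ = 1)
    (hratio : α * (1 + toPlace v w b * galAdicCompletionMap (L := L) (IsCMField.complexConj L) hw ϖ) = γ * (1 + toPlace v w b * ϖ))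
    {N : ℕ} (hN : Valued.v (α - γ) = Valued.v ϖ ^ N) :
    Valued.v b = Valued.v ϖF ^ ((N - d) / 2) ∧
      valuation (v.adicCompletion ↥(maximalRealSubfield L)) b = valuation (v.adicCompletion ↥(maximalRealSubfield L)) ϖF ^ ((N - d) / 2) ∧
      d ≤ N ∧ N % 2 = d % 2 := by
  have hϖ := hD.2.2.1
  have hb1F : Valued.v b ≤ 1 := (v_le_one_iff_mem_integer b).2 hb
  have hb1 : Valued.v (toPlace v w b) ≤ 1 := by
    rw [valued_toPlace_eq_sq_of_ramified L v w hw he]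
    exact pow_le_one₀ zero_le hb1F
  obtain ⟨hq, hdN, hpar⟩ := valued_toPlace_eq_pow_of_depth L v w hw hD hb0 hb1 hγ1 hratio hN
  -- `|b|_v² = |ι b|_w = |ϖ|^{N − d}`; read exponents
  have hvb0 : Valued.v b ≠ 0 := (Valuation.ne_zero_iff _).2 hb0
  obtain ⟨m, hm⟩ : ∃ m : ℤ, Valued.v b = WithZero.exp m :=
    ⟨Multiplicative.toAdd (WithZero.unzero hvb0), by rw [WithZero.exp, ofAdd_toAdd, WithZero.coe_unzero]⟩
  have hsq : Valued.v b ^ 2 = Valued.v ϖ ^ (N - d) := by rw [← valued_toPlace_eq_sq_of_ramified L v w hw he, hq]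
  rw [hm, valuation_pow_eq_exp hϖ, ← WithZero.exp_nsmul, nsmul_eq_mul] at hsq
  have h2m : 2 * m = -((N - d : ℕ) : ℤ) := WithZero.exp_injective hsq
  have hV : Valued.v b = Valued.v ϖF ^ ((N - d) / 2) := by
    rw [hm, valuation_pow_eq_exp hϖF]
    congr 1
    push_cast [Nat.cast_sub hdN] at h2m ⊢
    omega
  refine ⟨hV, ?_, hdN, hpar⟩
  have h := (v_eq_iff_valuation_eq b (ϖF ^ ((N - d) / 2))).1 (by rw [map_pow]; exact hV)
  rwa [map_pow] at h

end Place

end Summit.HodgeConjecture.HodgeConjecture.Cruxes.H413.F0P3cDyRamTypeOneTorusConductor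

end
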